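/-
Copyright (c) 2026 the pub-hodgecm-mathlib formalisation cell (harness21).  Prover seat hodgecm-mathlib-K2E3-p26 (g3), Track B «K2-LIT»,
#184♮ = hLiu418 = `stmt-HodgeConjecture-24832`; socket #41, KIND W, brick (KW-fac-read) (KW desk F0P2-p08 (g3) DEAL 2026-09-05T00:16:12Z):
THE READINGS OF ★ (KW-fac) `exists_kindW_factorization` INTO THE KIND-W HEAD'S BINDER BYTES `hfac` (★ p862959 :145–147 ≡ ★ ED. 4 :95–98) AND
`hsum` (★ ED. 4 :104–107), so the tie writes no algebra.
THEOREMS ONLY (no `def`, no `instance`, no notation, no named-fact hypothesis, no `sorry`); lane `--supports stmt-HodgeConjecture-24832` (count-neutral helper).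
-/
import Summits.HodgeConjecture.HodgeConjecture.Theorems.K2LiuKindWFactorizableDecomposition  -- ★ (KW-fac) p863379 `exists_kindW_factorization` (brings `placesEmbed`, `LambdaLoc`, `modDelta`, `IwasawaDatum.pPart`)
import Summits.HodgeConjecture.HodgeConjecture.Theorems.K2LiuSiegelEisensteinKindWLetters      -- ★ (x-a) ED. 1–2 `kindWFinset`, `subset_kindWFinset`
import HarnessLib

/-!
# Crux `HLiu418`, socket #41, KIND W, brick (KW-fac-read) — `K2LiuKindWFactorizationReadings`: THE (KW-fac) FACTORIZATION READ INTO THE HEAD'S `hfac` AND `hsum`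

Cell `hodgecm-mathlib`, crux item hLiu418 = `stmt-HodgeConjecture-24832` (helper lane `--supports … --as helper`, count-neutral), route of record `HCCMUnconditional`;
squad K2 ∕ K2Liu, road `K2_Liu`, socket #41 `sig_K2LiuSiegelEisensteinContinuation`, KIND W; author K2E3-p26 (g3); KW desk F0P2-p08 (g3).
★ (KW-fac) `K2LiuKindWFactorizableDecomposition.exists_kindW_factorization` (this seat's lineage, p863379) presents a STANDARD section family `f` off a finite set
`S₀`: (1) `χ` unramified off `S₀`; (2) for every `T ⊇ S₀`, `f` is factorizable off `T` through its own `T`-slices `s x ↦ f s (placesEmbed T x)`; (3) letters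
`m, b, A` with `f s (placesEmbed T (y_∞, y)) = Σ_i (H_∞(y_∞)^{2(s−s₀)}·A_i y_∞) · ∏_{v:T} [v ∈ S₀ ? H_v(y_v)^{2(s−s₀)}·b_{i,v}(y_v) : Λ_{s,v}(y_v)]` for EVERY `T ⊇ S₀`.
The KIND-W head (★ p862959 `kindW_block_of_record` ∕ ★ (a) `kindW_block_cm_of_localLetters` ∕ ★ (x-a) ED. 4 `exists_kindW_eulerLetters_of_localLetters`) takes BY VALUE
the split families `{fT} (hfac : ∀ T ⊇ T₀, IsFactorizableOff T χ f (fT T))` and the Σ⊗ structure `{m} FinfT FvT (hsum : fT (kindWFinset T₀ ↑S h) s (a, x) = Σ_j FinfT j S h s a ·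
∏_{v : kindWFinset T₀ ↑S h} FvT j S h v s (x v))`.  THIS FILE is the ADAPTER between the two — the three READINGS
`fT := fun T s x => f s (placesEmbed T x)`, `FinfT j S h s a := H_∞(a)^{2(s−s₀)}·A j a`, `FvT j S h v s y := if v.1 ∈ S₀ then H_v(y)^{2(s−s₀)}·b j v.1 y else Λ_{s,v.1}(y)`
are stated as EQUATIONS (`hfT`, `hreadArch`, `hread` — the tie passes its own terms and `rfl` ∕ `fun … => rfl`; `hread` in ★ p863446 `hint_joint_of_reading`'s bytes,
`hreadArch` in K2Liu-p11 (g5)'s `hintArch_of_std` bytes), and for `S₀ ⊆ T₀`: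
* §1 **`hfac_of_factorization`** — the head's `hfac` BYTES from (KW-fac)'s conjunct (2) (`S₀ ⊆ T₀ ⊆ T`).
* §2 **`hsum_of_factorization`** — ★ ED. 4's `hsum` BYTES from (KW-fac)'s slice identity (3) at `T := kindWFinset T₀ ↑S h` (★ `subset_kindWFinset`: `T₀ ⊆ kindWFinset T₀ ↑S h`)
  and the two readings backwards (`Finset.sum_congr` ∕ `Fintype.prod_congr`).
* §3 **`exists_kindW_factorization_readings`** — the ONE-OBTAIN PACKAGE: ★ (KW-fac) ∘ §1 ∘ §2 with the three readings INSTANTIATED (`fT`, `FinfT`, and `FvT T₀` for every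
  `T₀`), exporting (KW-fac)'s letters `hχS₀`, `hb₀`, `hb` (★ p863446's `hb`), `hfin`, `hAc`, `hAlaw` (K2Liu-p11's §3∕§4 inputs) verbatim, the readings as equations, and
  for every `T₀ ⊇ S₀` the head's `hfac` and `hsum` bytes (`FvT := FvT T₀`).
NOT HERE (by value elsewhere; each with a named payer): the joint integrability `hint` (★ p863446 `hint_joint_of_reading` ∘ K2Liu-p11 `hintArch_of_std`); the continued
letters `Finf Ffin` and `hFinfI hFfinI hFinf hFfin hFinf0` (LH4-p08∕p10, K2E3-p29); the junction `S₀ ⊆ T₀` itself (the head's `T₀` must absorb (KW-fac)'s `S₀`).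
[Tan1999, §1 p. 166, §3]; [KudlaRallis1994, §1]; [HarrisKudlaSweet1996, §1 (1.15)–(1.17)]; [Liu2011, §2B p. 862]; [BorelJacquet1979, §4.1]; [Flath1979, §2].

HONEST LABEL.  Count-neutral helper; it retires nothing by itself: `HC_CM` is proved only modulo the 7 printed citations (2 remaining named inputs:
hLiu418 = `stmt-HodgeConjecture-24832`, h413 = `stmt-HodgeConjecture-24833`) until rung 0 closes.

## References
* [Tan1999] V. Tan, *Poles of Siegel Eisenstein series on U(n,n)*, Canad. J. Math. 51 (1999), §1 p. 166 (`Φ(g, s) = Φ_v ⊗ Φ^v`, standard sections), §3.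
* [KudlaRallis1994] S. Kudla, S. Rallis, *A regularized Siegel–Weil formula: the first term identity*, Ann. of Math. 140 (1994), §1.
* [HarrisKudlaSweet1996] M. Harris, S. Kudla, W. J. Sweet, *Theta dichotomy for unitary groups*, J. AMS 9 (1996), §1 (1.15)–(1.17).
* [Liu2011] Y. Liu, *Arithmetic theta lifting and L-derivatives for unitary groups I*, Algebra & Number Theory 5 (2011), §2B p. 862.
* [BorelJacquet1979] A. Borel, H. Jacquet, *Automorphic forms and automorphic representations*, Proc. Sympos. Pure Math. 33.1 (1979), §4.1.
* [Flath1979] D. Flath, *Decomposition of representations into tensor products*, Proc. Sympos. Pure Math. 33.1 (1979), §2.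
-/

set_option autoImplicit false
-- the mandated namespace repeats the single-problem summit's segment (`HodgeConjecture.HodgeConjecture`)
set_option linter.dupNamespace false

noncomputable section

open scoped Matrix RestrictedProduct
open Filter Topology Set NumberField IsDedekindDomain
open Literature.NumberTheory.Automorphic hiding IsKFinite
open Literature.NumberTheory.Automorphic.UnitaryGroup Literature.NumberTheory.GaloisRepresentations
open Literature.NumberTheory.GelbartRogawski1991 Literature.NumberTheory.GelbartRogawski1991.GRConstruction
open Literature.NumberTheory.GelbartRogawski1991.UnitaryDualPair Literature.NumberTheory.GelbartRogawski1991.UnitaryDualPair.LocalSplitting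
open Literature.NumberTheory.K2Lit.SiegelDoubled Literature.NumberTheory.K2Lit.LocalSiegelDoubled Literature.NumberTheory.K2Lit.PlaceSplitting
open Summit.HodgeConjecture.HodgeConjecture.Cruxes.HLiu418.K2LiuSiegelUnipotentFourierDefs (skewMatrices)
open Summit.HodgeConjecture.HodgeConjecture.Cruxes.HLiu418.K2LiuSiegelEisensteinKindWLetters (kindWFinset subset_kindWFinset)
open Summit.HodgeConjecture.HodgeConjecture.Cruxes.HLiu418.K2LiuKindWFactorizableDecomposition (exists_kindW_factorization)

namespace Summit.HodgeConjecture.HodgeConjecture.Cruxes.HLiu418.K2LiuKindWFactorizationReadings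

variable (L : Type) [Field L] [NumberField L] [IsCMField L]
variable {N M n : ℕ} (e : Fin N × Fin M ≃ Fin n)
  (dV : Fin N → L) (hdV : ∀ i, IsCMField.complexConj L (dV i) = dV i)
  (dW : Fin M → L) (hdW : ∀ i, IsCMField.complexConj L (dW i) = dW i)
  [DecidableEq (HeightOneSpectrum (𝓞 (Fp L)))]

/-! ## §1 The head's `hfac` from (KW-fac)'s conjunct (2) -/

section Fac

variable {χ : HeckeCharacter L} {f : ℂ → HA L e dV hdV dW hdW → ℂ} {S₀ T₀ : Finset (HeightOneSpectrum (𝓞 (Fp L)))}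

/-- **THE HEAD's `hfac` FROM (KW-fac).**  If `f` is factorizable off every `T ⊇ S₀` through its own `T`-slices ((KW-fac)'s conjunct (2), by value as `hfacS₀`),
`S₀ ⊆ T₀`, and `fT` IS the slice family (reading `hfT`), then `∀ T ⊇ T₀, IsFactorizableOff T χ f (fT T)` — ★ p862959's ∕ ★ ED. 4's binder `hfac` token for token.
[cite: Tan1999, §1 p. 166] [cite: Liu2011, §2B p. 862] [cite: BorelJacquet1979, §4.1] -/
theorem hfac_of_factorization (hS₀T₀ : S₀ ⊆ T₀)
    (hfacS₀ : ∀ T : Finset (HeightOneSpectrum (𝓞 (Fp L))), S₀ ⊆ T →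
      IsFactorizableOff L e dV hdV dW hdW T χ f (fun s x => f s (placesEmbed L (hermD L e dV hdV dW hdW) T x)))
    {fT : ∀ T : Finset (HeightOneSpectrum (𝓞 (Fp L))), ℂ → UnitaryGroup.arch (Fp L) L (IsCMField.complexConj L) (n + n) (hermD L e dV hdV dW hdW) ×
      (Π v : T, UnitaryGroup.localPi L (IsCMField.complexConj L) (n + n) (hermD L e dV hdV dW hdW) v.1) → ℂ}
    (hfT : fT = fun T s x => f s (placesEmbed L (hermD L e dV hdV dW hdW) T x)) :
    ∀ T : Finset (HeightOneSpectrum (𝓞 (Fp L))), T₀ ⊆ T → IsFactorizableOff L e dV hdV dW hdW T χ f (fT T) := by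
  subst hfT
  exact fun T hT => hfacS₀ T (hS₀T₀.trans hT)

end Fac

/-! ## §2 ★ ED. 4's `hsum` from (KW-fac)'s slice identity (3) at `T := kindWFinset T₀ ↑S h` -/

section Sum

variable {χ : HeckeCharacter L} {f : ℂ → HA L e dV hdV dW hdW → ℂ} {S₀ T₀ : Finset (HeightOneSpectrum (𝓞 (Fp L)))}

/-- **★ ED. 4's `hsum` FROM (KW-fac).**  BY VALUE: `S₀ ⊆ T₀`; an Iwasawa datum `𝒦` and abscissa `s₀` (the heights `H_∞ = modDelta ∘ 𝒦.pPart ∘ ι_∞`, `H_v = modDelta ∘ 𝒦.pPart ∘ ι_v`);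
(KW-fac)'s letters `m, b, A` with its SLICE IDENTITY `hslice` ((KW-fac)'s last conjunct verbatim: for every `T ⊇ S₀`,
`f s (placesEmbed T (y_∞, y)) = Σ_i (H_∞(y_∞)^{2(s−s₀)}·A i y_∞) · ∏_{v:T} [v ∈ S₀ ? H_v(y_v)^{2(s−s₀)}·b i v (y_v) : Λ_{s,v}(y_v)]`); and the three READINGS as equations —
`hfT : fT = (T s x ↦ f s (placesEmbed T x))`, `hreadArch : FinfT j S h s a = H_∞(a)^{2(s−s₀)}·A j a` (K2Liu-p11's `hintArch_of_std` bytes, order `S h s j a`),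
`hread : FvT j S h v s y = if v.1 ∈ S₀ then H_v(y)^{2(s−s₀)}·b j v.1 y else Λ_{s,v.1}(y)` (★ p863446 `hint_joint_of_reading`'s bytes, order `j S h v s y`).
THEN ★ ED. 4's `hsum` (:106–107) token for token: `fT (kindWFinset T₀ ↑S h) s (a, x) = Σ_j FinfT j S h s a · ∏_{v : kindWFinset T₀ ↑S h} FvT j S h v s (x v)` — `hslice` at
`T := kindWFinset T₀ ↑S h ⊇ T₀ ⊇ S₀` (★ `subset_kindWFinset`) and the readings backwards.
[cite: Tan1999, §1 p. 166] [cite: KudlaRallis1994, §1] [cite: HarrisKudlaSweet1996, §1 (1.15)–(1.17)] [cite: Liu2011, §2B p. 862] [cite: Flath1979, §2] -/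
theorem hsum_of_factorization (hS₀T₀ : S₀ ⊆ T₀) (𝒦 : IwasawaDatum L e dV hdV dW hdW) (s₀ : ℂ) {m : ℕ}
    (b : Fin m → (v : HeightOneSpectrum (𝓞 (Fp L))) → (UnitaryGroup.localPi L (IsCMField.complexConj L) (n + n) (hermD L e dV hdV dW hdW) v → ℂ))
    (A : Fin m → UnitaryGroup.arch (Fp L) L (IsCMField.complexConj L) (n + n) (hermD L e dV hdV dW hdW) → ℂ)
    (hslice : ∀ T : Finset (HeightOneSpectrum (𝓞 (Fp L))), S₀ ⊆ T →
      ∀ (s : ℂ) (yi : UnitaryGroup.arch (Fp L) L (IsCMField.complexConj L) (n + n) (hermD L e dV hdV dW hdW))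
        (y : Π v : ↥T, UnitaryGroup.localPi L (IsCMField.complexConj L) (n + n) (hermD L e dV hdV dW hdW) v.1),
        f s (placesEmbed L (hermD L e dV hdV dW hdW) T (yi, y)) =
          ∑ i, (((modDelta L e dV hdV dW hdW (𝒦.pPart (UnitaryGroup.archToAdelic (Fp L) L (IsCMField.complexConj L) (n + n) (hermD L e dV hdV dW hdW) yi)) : ℝ) : ℂ) ^ (2 * (s - s₀)) * A i yi) *
            ∏ v : ↥T, (if v.1 ∈ S₀
              then ((modDelta L e dV hdV dW hdW (𝒦.pPart (locToAdelic L e dV hdV dW hdW v.1 (y v))) : ℝ) : ℂ) ^ (2 * (s - s₀)) * b i v.1 (y v) else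
              LambdaLoc L e dV hdV dW hdW v.1 χ s (y v)))
    {fT : ∀ T : Finset (HeightOneSpectrum (𝓞 (Fp L))), ℂ → UnitaryGroup.arch (Fp L) L (IsCMField.complexConj L) (n + n) (hermD L e dV hdV dW hdW) ×
      (Π v : T, UnitaryGroup.localPi L (IsCMField.complexConj L) (n + n) (hermD L e dV hdV dW hdW) v.1) → ℂ}
    (hfT : fT = fun T s x => f s (placesEmbed L (hermD L e dV hdV dW hdW) T x))
    (FinfT : Fin m → skewMatrices ((IsCMField.complexConj L : L ≃ₐ[Fp L] L) : L →+* L) ((gramR L e dV hdV dW hdW).map (algebraMap (Fp L) L)) → HA L e dV hdV dW hdW → ℂ →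
      UnitaryGroup.arch (Fp L) L (IsCMField.complexConj L) (n + n) (hermD L e dV hdV dW hdW) → ℂ)
    (hreadArch : ∀ (S : skewMatrices ((IsCMField.complexConj L : L ≃ₐ[Fp L] L) : L →+* L) ((gramR L e dV hdV dW hdW).map (algebraMap (Fp L) L))) (h : HA L e dV hdV dW hdW)
      (s : ℂ) (j : Fin m) (a : UnitaryGroup.arch (Fp L) L (IsCMField.complexConj L) (n + n) (hermD L e dV hdV dW hdW)),
      FinfT j S h s a =
        ((modDelta L e dV hdV dW hdW (𝒦.pPart (UnitaryGroup.archToAdelic (Fp L) L (IsCMField.complexConj L) (n + n) (hermD L e dV hdV dW hdW) a)) : ℝ) : ℂ) ^ (2 * (s - s₀)) * A j a)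
    (FvT : Fin m → ∀ (S : skewMatrices ((IsCMField.complexConj L : L ≃ₐ[Fp L] L) : L →+* L) ((gramR L e dV hdV dW hdW).map (algebraMap (Fp L) L)))
      (h : HA L e dV hdV dW hdW) (v : (kindWFinset L e dV hdV dW hdW T₀ (S : Matrix (Fin n) (Fin n) L) h)),
      ℂ → UnitaryGroup.localPi L (IsCMField.complexConj L) (n + n) (hermD L e dV hdV dW hdW) v.1 → ℂ)
    (hread : ∀ (j : Fin m) (S : skewMatrices ((IsCMField.complexConj L : L ≃ₐ[Fp L] L) : L →+* L) ((gramR L e dV hdV dW hdW).map (algebraMap (Fp L) L)))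
      (h : HA L e dV hdV dW hdW) (v : (kindWFinset L e dV hdV dW hdW T₀ (S : Matrix (Fin n) (Fin n) L) h)) (s : ℂ)
      (y : UnitaryGroup.localPi L (IsCMField.complexConj L) (n + n) (hermD L e dV hdV dW hdW) v.1),
      FvT j S h v s y = if v.1 ∈ S₀ then ((modDelta L e dV hdV dW hdW (𝒦.pPart (locToAdelic L e dV hdV dW hdW v.1 y)) : ℝ) : ℂ) ^ (2 * (s - s₀)) * b j v.1 y
        else LambdaLoc L e dV hdV dW hdW v.1 χ s y) :
    ∀ (S : skewMatrices ((IsCMField.complexConj L : L ≃ₐ[Fp L] L) : L →+* L) ((gramR L e dV hdV dW hdW).map (algebraMap (Fp L) L))) (h : HA L e dV hdV dW hdW) (s : ℂ)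
      (a : UnitaryGroup.arch (Fp L) L (IsCMField.complexConj L) (n + n) (hermD L e dV hdV dW hdW))
      (x : Π v : (kindWFinset L e dV hdV dW hdW T₀ (S : Matrix (Fin n) (Fin n) L) h), UnitaryGroup.localPi L (IsCMField.complexConj L) (n + n) (hermD L e dV hdV dW hdW) v.1),
      fT (kindWFinset L e dV hdV dW hdW T₀ (S : Matrix (Fin n) (Fin n) L) h) s (a, x) =
        ∑ j, FinfT j S h s a * ∏ v : (kindWFinset L e dV hdV dW hdW T₀ (S : Matrix (Fin n) (Fin n) L) h), FvT j S h v s (x v) := by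
  subst hfT
  intro S h s a x
  beta_reduce
  rw [hslice (kindWFinset L e dV hdV dW hdW T₀ (S : Matrix (Fin n) (Fin n) L) h)
    (hS₀T₀.trans (subset_kindWFinset L e dV hdV dW hdW T₀ (S : Matrix (Fin n) (Fin n) L) h)) s a x]
  refine Finset.sum_congr rfl fun j _ => ?_
  rw [hreadArch S h s j a]
  congr 1
  exact Fintype.prod_congr _ _ fun v => (hread j S h v s (x v)).symm

end Sum

/-! ## §3 The one-obtain package: ★ (KW-fac) with the three readings instantiated -/

section Package

variable (hdV0 : ∀ i, dV i ≠ 0) (hdW0 : ∀ i, dW i ≠ 0)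

include hdV0 hdW0 in
/-- **THE (KW-fac) FACTORIZATION WITH ITS READINGS, ONE `obtain` FOR THE TIE.**  For a STANDARD Iwasawa datum `𝒦`, a `𝒦`-standard family `f` for `χ` of continuous sections and an
abscissa `s₀`, there are `S₀` with `χ` unramified off `S₀` (`hχS₀`), letters `m, b, A` with (KW-fac)'s per-factor letters VERBATIM — `hb₀` (`b i v ∈ I_v(s₀,χ_v)` on `S₀`), `hb`
(the flat twists `H_v^{2(s−s₀)}·b i v ∈ I_v(s,χ_v)`, ★ p863446's `hb`), `hfin` (`A i` is `𝒦.K ∩ H_∞`-finite), `hAc` (continuity), `hAlaw` (the Siegel law of `A i` at `s₀` through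
`finPart = 1`; K2Liu-p11's `hintArch_of_std` inputs) —, and families `fT`, `FinfT`, `FvT T₀` (one for every `T₀`) satisfying the three READING equations
(`fT T s x = f s (placesEmbed T x)`, `hreadArch`, `hread`), such that for EVERY `T₀ ⊇ S₀` the KIND-W head's `hfac` (§1) and ★ ED. 4's `hsum` (§2, `FvT := FvT T₀`) hold.
Proof: ★ `exists_kindW_factorization`; the readings ARE the witnesses, so `hfac` ∕ `hsum` are its conjuncts (2) ∕ (3) up to `β` (= §1 ∕ §2 at `rfl`).
[cite: Tan1999, §1 p. 166, §3] [cite: KudlaRallis1994, §1] [cite: HarrisKudlaSweet1996, §1 (1.15)–(1.17)] [cite: Liu2011, §2B p. 862] [cite: BorelJacquet1979, §4.1]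
[cite: Flath1979, §2] -/
theorem exists_kindW_factorization_readings {𝒦 : IwasawaDatum L e dV hdV dW hdW} (h𝒦 : 𝒦.IsStd)
    {χ : HeckeCharacter L} {f : ℂ → HA L e dV hdV dW hdW → ℂ} (hf : IsStandardSectionFamily 𝒦 χ f) (hfc : ∀ s, Continuous (f s)) (s₀ : ℂ) :
    ∃ S₀ : Finset (HeightOneSpectrum (𝓞 (Fp L))),
      (∀ v, v ∉ S₀ → ∀ w : UnitaryGroup.PlacesOver L v, χ.IsUnramifiedAt w.1) ∧
      ∃ (m : ℕ) (b : Fin m → (v : HeightOneSpectrum (𝓞 (Fp L))) → (UnitaryGroup.localPi L (IsCMField.complexConj L) (n + n) (hermD L e dV hdV dW hdW) v → ℂ))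
        (A : Fin m → UnitaryGroup.arch (Fp L) L (IsCMField.complexConj L) (n + n) (hermD L e dV hdV dW hdW) → ℂ),
        -- `hb₀`: (KW-fac)'s letter at `s₀`
        (∀ i, ∀ v ∈ S₀, b i v ∈ localDegPS (Fp L) L (IsCMField.complexConj L) (complexConj_imagUnit L) (imagUnit_ne_zero L) (imagUnit_mul_self L)
          v n (gramR_isSymm L e dV hdV dW hdW) (hermD_eq_map_gramD L e dV hdV dW hdW) (fun w => χ.localComponent w.1) s₀) ∧
        -- `hb`: the flat twists at every `s` (★ p863446 `hint_joint_of_reading`'s `hb`)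
        (∀ i, ∀ v ∈ S₀, ∀ s : ℂ, (fun u => ((modDelta L e dV hdV dW hdW (𝒦.pPart (locToAdelic L e dV hdV dW hdW v u)) : ℝ) : ℂ) ^ (2 * (s - s₀)) * b i v u) ∈
          localDegPS (Fp L) L (IsCMField.complexConj L) (complexConj_imagUnit L) (imagUnit_ne_zero L) (imagUnit_mul_self L)
            v n (gramR_isSymm L e dV hdV dW hdW) (hermD_eq_map_gramD L e dV hdV dW hdW) (fun w => χ.localComponent w.1) s) ∧
        -- `hfin`: `A i` is `K_∞`-finite for `𝒦.K`
        (∀ i, (∃ V : Submodule ℂ (UnitaryGroup.arch (Fp L) L (IsCMField.complexConj L) (n + n) (hermD L e dV hdV dW hdW) → ℂ), FiniteDimensional ℂ V ∧ A i ∈ V ∧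
          ∀ a₀ : UnitaryGroup.arch (Fp L) L (IsCMField.complexConj L) (n + n) (hermD L e dV hdV dW hdW),
            (UnitaryGroup.archToAdelic (Fp L) L (IsCMField.complexConj L) (n + n) (hermD L e dV hdV dW hdW) a₀ : HA L e dV hdV dW hdW) ∈ 𝒦.K → ∀ G ∈ V, (fun x => G (x * a₀)) ∈ V)) ∧
        -- `hAc`: continuity
        (∀ i, Continuous (A i)) ∧
        -- `hAlaw`: the archimedean Siegel law of `A i` at `s₀` through `finPart = 1`
        (∀ i, (∀ p : HA L e dV hdV dW hdW, IsSiegelDelta L e dV hdV dW hdW p → UnitaryGroup.finPart (Fp L) L (IsCMField.complexConj L) (n + n) (hermD L e dV hdV dW hdW) p = 1 →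
          ∀ x : UnitaryGroup.arch (Fp L) L (IsCMField.complexConj L) (n + n) (hermD L e dV hdV dW hdW),
            A i (UnitaryGroup.archPart (Fp L) L (IsCMField.complexConj L) (n + n) (hermD L e dV hdV dW hdW) p * x) = siegelDeltaCharacter L e dV hdV dW hdW χ s₀ p * A i x)) ∧
        ∃ (fT : ∀ T : Finset (HeightOneSpectrum (𝓞 (Fp L))), ℂ → UnitaryGroup.arch (Fp L) L (IsCMField.complexConj L) (n + n) (hermD L e dV hdV dW hdW) ×
            (Π v : T, UnitaryGroup.localPi L (IsCMField.complexConj L) (n + n) (hermD L e dV hdV dW hdW) v.1) → ℂ)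
          (FinfT : Fin m → skewMatrices ((IsCMField.complexConj L : L ≃ₐ[Fp L] L) : L →+* L) ((gramR L e dV hdV dW hdW).map (algebraMap (Fp L) L)) → HA L e dV hdV dW hdW → ℂ →
            UnitaryGroup.arch (Fp L) L (IsCMField.complexConj L) (n + n) (hermD L e dV hdV dW hdW) → ℂ)
          (FvT : ∀ T₀ : Finset (HeightOneSpectrum (𝓞 (Fp L))), Fin m →
            ∀ (S : skewMatrices ((IsCMField.complexConj L : L ≃ₐ[Fp L] L) : L →+* L) ((gramR L e dV hdV dW hdW).map (algebraMap (Fp L) L))) (h : HA L e dV hdV dW hdW)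
              (v : (kindWFinset L e dV hdV dW hdW T₀ (S : Matrix (Fin n) (Fin n) L) h)),
              ℂ → UnitaryGroup.localPi L (IsCMField.complexConj L) (n + n) (hermD L e dV hdV dW hdW) v.1 → ℂ),
          -- the three READINGS as equations
          (∀ T s x, fT T s x = f s (placesEmbed L (hermD L e dV hdV dW hdW) T x)) ∧
          (∀ (S : skewMatrices ((IsCMField.complexConj L : L ≃ₐ[Fp L] L) : L →+* L) ((gramR L e dV hdV dW hdW).map (algebraMap (Fp L) L))) (h : HA L e dV hdV dW hdW)
            (s : ℂ) (j : Fin m) (a : UnitaryGroup.arch (Fp L) L (IsCMField.complexConj L) (n + n) (hermD L e dV hdV dW hdW)),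
            FinfT j S h s a =
              ((modDelta L e dV hdV dW hdW (𝒦.pPart (UnitaryGroup.archToAdelic (Fp L) L (IsCMField.complexConj L) (n + n) (hermD L e dV hdV dW hdW) a)) : ℝ) : ℂ) ^ (2 * (s - s₀)) *
                A j a) ∧
          (∀ (T₀ : Finset (HeightOneSpectrum (𝓞 (Fp L)))) (j : Fin m)
            (S : skewMatrices ((IsCMField.complexConj L : L ≃ₐ[Fp L] L) : L →+* L) ((gramR L e dV hdV dW hdW).map (algebraMap (Fp L) L))) (h : HA L e dV hdV dW hdW)
            (v : (kindWFinset L e dV hdV dW hdW T₀ (S : Matrix (Fin n) (Fin n) L) h)) (s : ℂ)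
            (y : UnitaryGroup.localPi L (IsCMField.complexConj L) (n + n) (hermD L e dV hdV dW hdW) v.1),
            FvT T₀ j S h v s y = if v.1 ∈ S₀ then ((modDelta L e dV hdV dW hdW (𝒦.pPart (locToAdelic L e dV hdV dW hdW v.1 y)) : ℝ) : ℂ) ^ (2 * (s - s₀)) * b j v.1 y
              else LambdaLoc L e dV hdV dW hdW v.1 χ s y) ∧
          -- for every `T₀ ⊇ S₀`: the head's `hfac` and ★ ED. 4's `hsum`
          ∀ T₀ : Finset (HeightOneSpectrum (𝓞 (Fp L))), S₀ ⊆ T₀ →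
            (∀ T : Finset (HeightOneSpectrum (𝓞 (Fp L))), T₀ ⊆ T → IsFactorizableOff L e dV hdV dW hdW T χ f (fT T)) ∧
            ∀ (S : skewMatrices ((IsCMField.complexConj L : L ≃ₐ[Fp L] L) : L →+* L) ((gramR L e dV hdV dW hdW).map (algebraMap (Fp L) L))) (h : HA L e dV hdV dW hdW) (s : ℂ)
              (a : UnitaryGroup.arch (Fp L) L (IsCMField.complexConj L) (n + n) (hermD L e dV hdV dW hdW))
              (x : Π v : (kindWFinset L e dV hdV dW hdW T₀ (S : Matrix (Fin n) (Fin n) L) h),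
                UnitaryGroup.localPi L (IsCMField.complexConj L) (n + n) (hermD L e dV hdV dW hdW) v.1),
              fT (kindWFinset L e dV hdV dW hdW T₀ (S : Matrix (Fin n) (Fin n) L) h) s (a, x) =
                ∑ j, FinfT j S h s a * ∏ v : (kindWFinset L e dV hdV dW hdW T₀ (S : Matrix (Fin n) (Fin n) L) h), FvT T₀ j S h v s (x v) := by
  obtain ⟨S₀, hχS₀, hfacS₀, m, b, A, hb₀, hb, hfin, hAc, hAlaw, hslice⟩ := exists_kindW_factorization L e dV hdV hdV0 dW hdW hdW0 h𝒦 hf hfc s₀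
  refine ⟨S₀, hχS₀, m, b, A, hb₀, hb, hfin, hAc, hAlaw,
    fun T s x => f s (placesEmbed L (hermD L e dV hdV dW hdW) T x),
    fun j _ _ s a => ((modDelta L e dV hdV dW hdW (𝒦.pPart (UnitaryGroup.archToAdelic (Fp L) L (IsCMField.complexConj L) (n + n) (hermD L e dV hdV dW hdW) a)) : ℝ) : ℂ) ^
      (2 * (s - s₀)) * A j a,
    fun T₀ j _ _ v s y => if v.1 ∈ S₀ then ((modDelta L e dV hdV dW hdW (𝒦.pPart (locToAdelic L e dV hdV dW hdW v.1 y)) : ℝ) : ℂ) ^ (2 * (s - s₀)) * b j v.1 y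
      else LambdaLoc L e dV hdV dW hdW v.1 χ s y,
    fun _ _ _ => rfl, fun _ _ _ _ _ => rfl, fun _ _ _ _ _ _ _ => rfl, fun T₀ hS₀T₀ => ⟨fun T hT => hfacS₀ T (hS₀T₀.trans hT), fun S h s a x => ?_⟩⟩
  -- §2 inline (first-order: the readings are the witnesses themselves)
  beta_reduce
  exact hslice (kindWFinset L e dV hdV dW hdW T₀ (S : Matrix (Fin n) (Fin n) L) h)
    (hS₀T₀.trans (subset_kindWFinset L e dV hdV dW hdW T₀ (S : Matrix (Fin n) (Fin n) L) h)) s a x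

end Package

end Summit.HodgeConjecture.HodgeConjecture.Cruxes.HLiu418.K2LiuKindWFactorizationReadings

end
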